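import Summits.QuantumFields.YangMills.Theorems.UnitScaleTiltProp7TopMeanFrameRows
import Literature.MathematicalPhysics.QuantumFieldTheory.Balaban1983to89.B13BondAveragingReadingNumerals
import HarnessLib

/-!
# Route `UnitScaleTilt`, crux K1 «MinimiserStabilityRegPr» (stmt-QuantumFields-19200), EX row `hGF[Lift]` (curved member) — **LOD LINE, PEN (L5″) (M-III′) BINDER `hlen`:
# THE TWO COMB WALKS OF A BLOCK HAVE LENGTH `≤ d(L^{K−n} − 1)`** — discharges the length hypothesis `hlen` of ✓`Prop7TopMeanFrameRows.frameRow_of_walkFlat` (px5 p754796) and of its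
consumers (✓p755451 `norm_lift_topMean_sub_flat_le_of_tail`, ✓p757348): for `x ∈ B^{K−n}(Y)` both `|x − corner(B(x))|₁` and `|Y♯ − corner(B(x))|₁` (`Y♯ = embIter (K−n) Y ∈ B(Y)`,
✓`embIter_mem_iterBlock'`) are `≤ d·(L^{K−n} − 1)` (ROW-T's ✓`Prop7NestedMeanTowerCloseness.l1_rel_corner_le`); so `m := max 1 (d(L^{K−n} − 1))` serves.

Cell `ym3-torus` (HUMAN RULING D-0037, YM ladder rung R3 — NOT d = 4, NOT infinite volume, NOT a mass gap, NOT Clay).  Width seat `ym3-torus-px5` gen 11.  THEOREMS ONLY (0 `def`,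
0 `sorry`); `--supports stmt-QuantumFields-19200 --as helper`, count-neutral.  HONEST LABEL (★★OWNER RULING №33 (6)): curved γ-row supplier line (LOD localisation), pen (L5″); lattice
bookkeeping only; nothing of (3.49), Thm 3.1∕3.3, `h349`, `hGF`, EX ∕ 19200 is proved here.

References: T. Bałaban, CMP **95** (1984) 17–40 [Balaban1984PropagatorsI] ((1.7) p.18, (1.18) p.20); CMP **98** (1985) 17–51 [Balaban1985Averaging] (p.24).
-/

set_option autoImplicit false

noncomputable section

namespace Summit.QuantumFields.YangMills.Theorems.Prop7TopMeanFrameWalkLengths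

open Literature.MathematicalPhysics.QuantumFieldTheory.Balaban1983to89
open T4Continuum BlockAveraging
open B7Prop1Explicit (l1)
open B5Eq118OneStroke (iterBlockOf iterBlock mem_iterBlock)
open B15DeterminingSets (embIter)
open B10Eq27TorusAxialLog (rel)
open Literature.MathematicalPhysics.QuantumFieldTheory.Balaban1983to89.T3ContinuumYM3Torus
open Summit.QuantumFields.YangMills.Theorems.Prop7NestedMeanTowerCloseness (l1_rel_corner_le)
open B13BondAveragingReadingNumerals (embIter_mem_iterBlock')

variable (F : T3Family) {n K : ℕ}

/-- ★ **COMB LENGTH TO A BLOCK SITE**: for every fine `x`, `|x − corner(B^{K−n}(x))|₁ ≤ d·(L^{K−n} − 1)`. [cite: Balaban1984PropagatorsI, (1.7) p.18] -/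
theorem l1_rel_corner_site_le (x : Site (F.P K) 0) :
    l1 (rel (Site.fibreSite 0 (K - n) (iterBlockOf (K - n) x) fun _ => (⟨0, pow_pos (F.P K).L_pos (K - n)⟩ : Fin ((F.P K).L ^ (K - n)))) x) ≤ (F.P K).d * ((F.P K).L ^ (K - n) - 1) := by
  have hk : K - n ≤ (F.P K).m + (F.P K).K := by show K - n ≤ F.m + K; have := F.hm; omega
  exact l1_rel_corner_le hk rfl (pow_pos (F.P K).L_pos (K - n))

/-- ★ **COMB LENGTH TO THE BLOCK'S BASE POINT OF RECORD**: for `x ∈ B^{K−n}(Y)`, `|embIter (K−n) Y − corner(B(x))|₁ ≤ d·(L^{K−n} − 1)` (`embIter (K−n) Y ∈ B(Y) = B(x)`).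
[cite: Balaban1984PropagatorsI, (1.7) p.18, (1.18) p.20] -/
theorem l1_rel_corner_embIter_le (Y : Site (F.P K) (K - n)) (x : Site (F.P K) 0) (hx : x ∈ iterBlock (K - n) Y) :
    l1 (rel (Site.fibreSite 0 (K - n) (iterBlockOf (K - n) x) fun _ => (⟨0, pow_pos (F.P K).L_pos (K - n)⟩ : Fin ((F.P K).L ^ (K - n)))) (embIter (K - n) Y)) ≤ (F.P K).d * ((F.P K).L ^ (K - n) - 1) := by
  have hk : K - n ≤ (F.P K).m + (F.P K).K := by show K - n ≤ F.m + K; have := F.hm; omega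
  have hxY : iterBlockOf (K - n) x = Y := (mem_iterBlock (K - n) Y x).mp hx
  have heY : iterBlockOf (K - n) (embIter (K - n) Y) = iterBlockOf (K - n) x := by
    rw [hxY]; exact (mem_iterBlock (K - n) Y _).mp (embIter_mem_iterBlock' hk Y)
  exact l1_rel_corner_le hk heY (pow_pos (F.P K).L_pos (K - n))

/-- ★★ **THE BINDER `hlen` OF ✓`frameRow_of_walkFlat`∕✓`norm_lift_topMean_sub_flat_le_of_tail`∕✓`norm_lift_topMean_sub_flat_propagated_le`** with `m := max 1 (d·(L^{K−n} − 1))` (so that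
`1 ≤ m` holds too), for ANY cut-off `χ`. [cite: Balaban1984PropagatorsI, (1.7) p.18; Balaban1985Averaging, p.24] -/
theorem frameWalkLengths (χ : Site (F.P K) 0 → ℝ) :
    ∀ Y : Site (F.P K) (K - n), (∃ x ∈ iterBlock (K - n) Y, χ x ≠ 0) → ∀ x ∈ iterBlock (K - n) Y,
      l1 (rel (Site.fibreSite 0 (K - n) (iterBlockOf (K - n) x) fun _ => (⟨0, pow_pos (F.P K).L_pos (K - n)⟩ : Fin ((F.P K).L ^ (K - n)))) (embIter (K - n) Y)) ≤ max 1 ((F.P K).d * ((F.P K).L ^ (K - n) - 1)) ∧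
        l1 (rel (Site.fibreSite 0 (K - n) (iterBlockOf (K - n) x) fun _ => (⟨0, pow_pos (F.P K).L_pos (K - n)⟩ : Fin ((F.P K).L ^ (K - n)))) x) ≤ max 1 ((F.P K).d * ((F.P K).L ^ (K - n) - 1)) :=
  fun Y _ x hx => ⟨(l1_rel_corner_embIter_le F Y x hx).trans (le_max_right _ _), (l1_rel_corner_site_le F x).trans (le_max_right _ _)⟩

/-- `1 ≤ max 1 (d·(L^{K−n} − 1))` — the `hm1` companion of ✓`frameWalkLengths`. [folklore] [cite: Balaban1985Averaging, p.24] -/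
theorem one_le_frameWalkBound : 1 ≤ max 1 ((F.P K).d * ((F.P K).L ^ (K - n) - 1)) := le_max_left _ _

end Summit.QuantumFields.YangMills.Theorems.Prop7TopMeanFrameWalkLengths
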